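import Summits.Parity.BatemanHorn.Theorems.AlmostPrimeZerosSystemLSDRealSegmentEulerFactorAux
import HarnessLib

/-!
# Route `AlmostPrimeZeros`, crux `SystemLSDRealSegment` (stmt-Parity-11292), line
# `beta-thinned-root-kernel`: the registered stub `stub_eulerFactor`

For a Bateman–Horn system `f = (f₁, …, f_k)` the EXPLICIT Euler factor
`λ_f(z) = eulerFactor f z = lim_N ∏_{p ≤ N} E_p(z) (1 − 1/p)^{k(z−1)}` (ordered product of the local
tilted means `E_p = localFactor f p` of `Summits/Parity/BatemanHorn/Theorems/AlmostPrimeZerosDefs.lean`)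
is holomorphic on `|z| < 2` and `λ_f(0) = batemanHornConst f` (`EulerFactorClause k f`), granted the
local counts `LocalCounts k f` (registered separately as `stub_congruenceFacts`).

Proof. Adjoin to the `p`-th factor the scalar `exp((z − 1)(k − ω_f(p))/p)`: by the local estimate
`E_p(z) = 1 + (z − 1)ω_f(p)/p + O(p⁻²)` (`…EulerFactorAux.lean`) and `|log(1 − 1/p) + 1/p| ≤ 2/p²` the
regularised factor is `1 + O(p⁻²)` uniformly on `‖z‖ ≤ 2`, so the regularised product converges locally
uniformly on the ball to a holomorphic `Φ` (Mathlib's `Summable.hasProdLocallyUniformlyOn_one_add` and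
`TendstoLocallyUniformlyOn.differentiableOn`); the scalars multiply to `exp(−(z − 1) Σ_{p≤N}(k − ω_f(p))/p)`,
which converges by the ORDERED convergence of `Σ_p (k − ω_f(p))/p`
(`AZFG2020_tendsto_sum_sub_omega_div_holds`, Bateman–Horn 1962 / prime ideal theorem input).  Hence
`λ_f = Φ · exp(−(z−1)L)` on the ball.  At `z = 0` the partial products ARE the Bateman–Horn partial
products (`E_p(0) = 1 − ω_f(p)/p`), which tend to `batemanHornConst f`
(`IsBatemanHornSystem.hasBatemanHornConst_holds`).
-/

open Filter Finset Polynomial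
open scoped BigOperators Topology

namespace Summit.Parity.BatemanHorn.Cruxes.SystemLSDRealSegment.BetaThinnedRootKernel

open Literature.NumberTheory.Sieve

/-! ### An elementary inequality -/

/-- `‖(1 + A + r)e^w − 1‖ ≤ 3‖r‖ + (1 + ‖A‖)‖w‖² + ‖A + w‖ + ‖A‖‖w‖` for `‖w‖ ≤ 1`
(`‖e^w‖ ≤ e ≤ 3`, `‖e^w − 1 − w‖ ≤ ‖w‖²`). [folklore] -/
theorem norm_one_add_add_mul_exp_sub_one_le (A r w : ℂ) (hw : ‖w‖ ≤ 1) :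
    ‖(1 + A + r) * Complex.exp w - 1‖ ≤
      3 * ‖r‖ + (1 + ‖A‖) * ‖w‖ ^ 2 + ‖A + w‖ + ‖A‖ * ‖w‖ := by
  have hexp : ‖Complex.exp w‖ ≤ 3 :=
    (Complex.norm_exp_le_exp_norm w).trans
      ((Real.exp_le_exp.mpr hw).trans Real.exp_one_lt_three.le)
  have h1 : (1 + A + r) * Complex.exp w - 1 =
      r * Complex.exp w + (1 + A) * (Complex.exp w - 1 - w) + ((A + w) + A * w) := by ring
  have e1 : ‖r * Complex.exp w‖ ≤ ‖r‖ * 3 := by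
    rw [norm_mul]
    gcongr
  have e2 : ‖(1 + A) * (Complex.exp w - 1 - w)‖ ≤ (1 + ‖A‖) * ‖w‖ ^ 2 := by
    rw [norm_mul]
    exact mul_le_mul ((norm_add_le _ _).trans_eq (by rw [norm_one]))
      (Complex.norm_exp_sub_one_sub_id_le hw) (norm_nonneg _) (by positivity)
  have e3 : ‖(A + w) + A * w‖ ≤ ‖A + w‖ + ‖A‖ * ‖w‖ :=
    (norm_add_le _ _).trans_eq (by rw [norm_mul])
  rw [h1]
  calc ‖r * Complex.exp w + (1 + A) * (Complex.exp w - 1 - w) + ((A + w) + A * w)‖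
      ≤ ‖r * Complex.exp w‖ + ‖(1 + A) * (Complex.exp w - 1 - w)‖ + ‖(A + w) + A * w‖ :=
        norm_add₃_le
    _ ≤ ‖r‖ * 3 + (1 + ‖A‖) * ‖w‖ ^ 2 + (‖A + w‖ + ‖A‖ * ‖w‖) := add_le_add_three e1 e2 e3
    _ = _ := by ring

/-- `Σ_n C/n²` converges. [folklore] -/
theorem summable_const_div_sq (C : ℝ) : Summable fun n : ℕ => C / (n : ℝ) ^ 2 := by
  simpa [div_eq_mul_one_div C] using (Real.summable_one_div_nat_pow.mpr one_lt_two).mul_left C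

variable {k : ℕ} (f : Fin k → ℤ[X])

/-! ### The regularised local factor is `1 + O(p⁻²)` -/

/-- **The regularised `p`-th factor is `1 + O(p⁻²)` uniformly on `‖z‖ ≤ 2`.** For a Bateman–Horn
system and all primes `p > P₁`:
`‖E_p(z) · exp((z − 1)(k log(1 − 1/p) + (k − ω_f(p))/p)) − 1‖ ≤ C/p²` (`ω_f(p) ≤ Σ deg fᵢ`,
`|log(1 − 1/p) + 1/p| ≤ 2/p²`, and the local estimate `E_p(z) = 1 + (z − 1)ω_f(p)/p + O(p⁻²)`).
[folklore] -/
theorem exists_norm_localFactor_mul_exp_sub_one_le (hf : IsBatemanHornSystem f)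
    (hLC : LocalCounts k f) :
    ∃ (P₁ : ℕ) (C : ℝ), 0 ≤ C ∧ ∀ p : ℕ, p.Prime → P₁ < p → ∀ z : ℂ, ‖z‖ ≤ 2 →
      ‖localFactor f p z * Complex.exp ((z - 1) *
          (((k : ℝ) * Real.log (1 - 1 / (p : ℝ)) + ((k : ℝ) - polyRootCountMod f p) / p : ℝ) : ℂ)) -
        1‖ ≤ C / (p : ℝ) ^ 2 := by
  obtain ⟨P₀, hP₀⟩ := hLC hf
  set D : ℕ := ∑ i, (f i).natDegree
  refine ⟨P₀ + 3 * (2 * k + D),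
    3 * (D * ((4 : ℝ) ^ k + 2)) + (1 + 3 * D) * (3 * (2 * k + D)) ^ 2 + 6 * k +
      3 * D * (3 * (2 * k + D)), by positivity, ?_⟩
  intro p hp hp1 z hz
  obtain ⟨h1, h2, h3⟩ := hP₀ p hp (by omega)
  have hp2 : (2 : ℝ) ≤ p := by exact_mod_cast hp.two_le
  have hp0 : (0 : ℝ) < p := by linarith
  -- notation
  set ω : ℕ := polyRootCountMod f p
  set ℓ : ℝ := Real.log (1 - 1 / (p : ℝ))
  set c : ℝ := (k : ℝ) * ℓ + ((k : ℝ) - ω) / p with hc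
  -- the small parameter `u = 1/p`
  set u : ℝ := 1 / p with hu
  have hu0 : 0 ≤ u := by positivity
  have hu2 : u ≤ 1 / 2 := by rw [hu]; gcongr
  have hu1 : u ≤ 1 := by linarith
  have huu : u ^ 2 ≤ u := by nlinarith
  have hW1 : 3 * (2 * k + D) * u ≤ 1 := by
    rw [hu, mul_one_div, div_le_one hp0]
    exact_mod_cast (show 3 * (2 * k + D) ≤ p by omega)
  have hωD : (ω : ℝ) ≤ D := by exact_mod_cast polyRootCountMod_le_sum_natDegree f hp h1
  -- the logarithm: `c = t − ω u` with `t = k (ℓ + u) = O(u²)`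
  have hℓu : |ℓ + u| ≤ 2 * u ^ 2 := abs_log_one_sub_add_le hu0 hu2
  set t : ℝ := k * (ℓ + u) with ht
  have htu : |t| ≤ 2 * k * u ^ 2 := by
    rw [ht, abs_mul, Nat.abs_cast]
    calc (k : ℝ) * |ℓ + u| ≤ k * (2 * u ^ 2) := by gcongr
      _ = _ := by ring
  have hct : c = t - ω * u := by
    rw [hc, ht, hu]
    field_simp
    ring
  have hcu : |c| ≤ (2 * k + D) * u := by
    rw [hct]
    calc |t - ω * u| ≤ |t| + |(ω : ℝ) * u| := abs_sub _ _
      _ ≤ 2 * k * u ^ 2 + D * u := by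
          rw [abs_of_nonneg (by positivity : (0 : ℝ) ≤ (ω : ℝ) * u)]
          gcongr
      _ ≤ 2 * k * u + D * u := by gcongr
      _ = (2 * k + D) * u := by ring
  -- the complex pieces
  have hz1 : ‖z - 1‖ ≤ 3 := (norm_sub_le z 1).trans (by rw [norm_one]; linarith)
  set A : ℂ := (z - 1) * (ω : ℂ) / p with hA
  set w : ℂ := (z - 1) * (c : ℂ) with hw
  set r : ℂ := localFactor f p z - (1 + (z - 1) * (ω : ℂ) / p) with hr
  have hrD : ‖r‖ ≤ D * ((4 : ℝ) ^ k + 2) * u ^ 2 := by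
    have h := norm_localFactor_sub_le f hp h2 h3 hz
    rw [hu, one_div, inv_pow, ← div_eq_mul_inv]
    exact h
  have hAn : ‖A‖ ≤ 3 * D * u := by
    rw [hA, norm_div, norm_mul, Complex.norm_natCast, Complex.norm_natCast]
    calc ‖z - 1‖ * ω / p ≤ 3 * D / p := by gcongr
      _ = 3 * D * u := by rw [hu]; ring
  have hwn : ‖w‖ ≤ 3 * (2 * k + D) * u := by
    rw [hw, norm_mul, Complex.norm_real, Real.norm_eq_abs]
    calc ‖z - 1‖ * |c| ≤ 3 * ((2 * k + D) * u) := by gcongr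
      _ = _ := by ring
  have hw1 : ‖w‖ ≤ 1 := hwn.trans hW1
  have hAw : ‖A + w‖ ≤ 6 * k * u ^ 2 := by
    have e : A + w = (z - 1) * (t : ℂ) := by
      rw [hA, hw, hct, hu]
      push_cast
      field_simp
      ring
    rw [e, norm_mul, Complex.norm_real, Real.norm_eq_abs]
    calc ‖z - 1‖ * |t| ≤ 3 * (2 * k * u ^ 2) := by gcongr
      _ = _ := by ring
  have hE : localFactor f p z * Complex.exp ((z - 1) * (c : ℂ)) - 1 =
      (1 + A + r) * Complex.exp w - 1 := by
    rw [hr, hA, hw]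
    ring
  rw [hE]
  calc ‖(1 + A + r) * Complex.exp w - 1‖
      ≤ 3 * ‖r‖ + (1 + ‖A‖) * ‖w‖ ^ 2 + ‖A + w‖ + ‖A‖ * ‖w‖ :=
        norm_one_add_add_mul_exp_sub_one_le A r w hw1
    _ ≤ 3 * (D * ((4 : ℝ) ^ k + 2) * u ^ 2) + (1 + 3 * D * u) * (3 * (2 * k + D) * u) ^ 2 +
          6 * k * u ^ 2 + (3 * D * u) * (3 * (2 * k + D) * u) := by gcongr
    _ = u ^ 2 * (3 * (D * ((4 : ℝ) ^ k + 2)) + (1 + 3 * D * u) * (3 * (2 * k + D)) ^ 2 + 6 * k +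
          3 * D * (3 * (2 * k + D))) := by ring
    _ ≤ u ^ 2 * (3 * (D * ((4 : ℝ) ^ k + 2)) + (1 + 3 * D * 1) * (3 * (2 * k + D)) ^ 2 + 6 * k +
          3 * D * (3 * (2 * k + D))) := by gcongr
    _ = _ := by rw [hu, mul_one]; field_simp

/-! ### The regularised product: locally uniform convergence and holomorphy -/

/-- `E_p` is an entire function (a polynomial in `z`). [folklore] -/
theorem differentiable_localFactor (p : ℕ) : Differentiable ℂ (localFactor f p) := by
  unfold localFactor
  fun_prop

/-- The regularised ordered product `∏_{n<N} (1 + [n prime](E_n(z) e^{(z−1)c_n} − 1))` converges locally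
uniformly on `|z| < 2` to a holomorphic function. [folklore] -/
theorem exists_differentiableOn_tendsto_prod (hf : IsBatemanHornSystem f) (hLC : LocalCounts k f) :
    ∃ Φ : ℂ → ℂ, DifferentiableOn ℂ Φ (Metric.ball 0 2) ∧ ∀ z ∈ Metric.ball (0 : ℂ) 2,
      Tendsto (fun N : ℕ => ∏ n ∈ range N, (1 + if n.Prime then
        localFactor f n z * Complex.exp ((z - 1) *
          (((k : ℝ) * Real.log (1 - 1 / (n : ℝ)) + ((k : ℝ) - polyRootCountMod f n) / n : ℝ) : ℂ)) - 1
        else 0)) atTop (𝓝 (Φ z)) := by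
  obtain ⟨P₁, C, hC0, hC⟩ := exists_norm_localFactor_mul_exp_sub_one_le f hf hLC
  set G : ℕ → ℂ → ℂ := fun n z => if n.Prime then
      localFactor f n z * Complex.exp ((z - 1) *
        (((k : ℝ) * Real.log (1 - 1 / (n : ℝ)) + ((k : ℝ) - polyRootCountMod f n) / n : ℝ) : ℂ)) - 1
      else 0 with hG
  have hdiff : ∀ n, Differentiable ℂ (G n) := by
    intro n
    by_cases hn : n.Prime
    · simp only [hG, hn, if_true]
      have := differentiable_localFactor f n
      fun_prop
    · simp only [hG, hn, if_false]
      fun_prop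
  have hbound : ∀ᶠ n in cofinite, ∀ z ∈ Metric.ball (0 : ℂ) 2, ‖G n z‖ ≤ C / (n : ℝ) ^ 2 := by
    rw [Nat.cofinite_eq_atTop, eventually_atTop]
    refine ⟨P₁ + 1, fun n hn z hz => ?_⟩
    simp only [hG]
    split_ifs with hn'
    · exact hC n hn' (by omega) z (mem_ball_zero_iff.mp hz).le
    · rw [norm_zero]
      positivity
  have hprod := (summable_const_div_sq C).hasProdLocallyUniformlyOn_one_add Metric.isOpen_ball hbound
    fun n => (hdiff n).continuous.continuousOn
  have htend := hprod.tendstoLocallyUniformlyOn_finsetRange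
  exact ⟨_, htend.differentiableOn (Eventually.of_forall fun N =>
      DifferentiableOn.fun_finsetProd fun n _ => ((hdiff n).const_add 1).differentiableOn)
    Metric.isOpen_ball, fun z hz => htend.tendsto_at hz⟩

/-! ### The partial products of `eulerFactor f` -/

/-- Regrouping of the partial products of `λ_f`:
`∏_{p≤N} E_p(z)(1 − 1/p)^{k(z−1)} = [∏_{n≤N} (1 + [n prime](E_n(z)e^{(z−1)c_n} − 1))] · exp(−(z−1) Σ_{p≤N} (k − ω_f(p))/p)`,
`c_p = k log(1 − 1/p) + (k − ω_f(p))/p`. [folklore] -/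
theorem prod_primesLE_eq (N : ℕ) (z : ℂ) :
    ∏ p ∈ Nat.primesLE N, localFactor f p z *
        Complex.exp ((k : ℂ) * (z - 1) * (Real.log (1 - 1 / (p : ℝ)) : ℂ)) =
      (∏ n ∈ range (N + 1), (1 + if n.Prime then
        localFactor f n z * Complex.exp ((z - 1) *
          (((k : ℝ) * Real.log (1 - 1 / (n : ℝ)) + ((k : ℝ) - polyRootCountMod f n) / n : ℝ) : ℂ)) - 1
        else 0)) *
      Complex.exp (-((z - 1) *
        ((∑ p ∈ Nat.primesLE N, ((k : ℝ) - polyRootCountMod f p) / p : ℝ) : ℂ))) := by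
  have hexp : Complex.exp (-((z - 1) *
      ((∑ p ∈ Nat.primesLE N, ((k : ℝ) - polyRootCountMod f p) / p : ℝ) : ℂ))) =
      ∏ p ∈ Nat.primesLE N,
        Complex.exp (-((z - 1) * ((((k : ℝ) - polyRootCountMod f p) / p : ℝ) : ℂ))) := by
    rw [← Complex.exp_sum, Complex.ofReal_sum, Finset.mul_sum, ← Finset.sum_neg_distrib]
  rw [hexp, Nat.primesLE_eq_filter_range, Finset.prod_filter, Finset.prod_filter,
    ← Finset.prod_mul_distrib]
  refine Finset.prod_congr rfl fun n _ => ?_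
  split_ifs with hn
  · rw [add_sub_cancel, mul_assoc (localFactor f n z), ← Complex.exp_add]
    congr 1
    congr 1
    push_cast
    ring
  · simp

/-- At `z = 0` the partial products of `λ_f` are the Bateman–Horn partial products:
`E_p(0) e^{−k log(1−1/p)} = (1 − 1/p)^{−k}(1 − ω_f(p)/p)`. [folklore] -/
theorem prod_primesLE_zero (N : ℕ) :
    ∏ p ∈ Nat.primesLE N, localFactor f p 0 *
        Complex.exp ((k : ℂ) * (0 - 1) * (Real.log (1 - 1 / (p : ℝ)) : ℂ)) =
      ((batemanHornPartial f N : ℝ) : ℂ) := by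
  unfold batemanHornPartial
  rw [Complex.ofReal_prod, Fintype.card_fin]
  refine Finset.prod_congr rfl fun p hp => ?_
  have hp' : p.Prime := (Nat.mem_primesLE.mp hp).2
  have hpos : 0 < 1 - 1 / (p : ℝ) := by
    have h2 : (2 : ℝ) ≤ p := by exact_mod_cast hp'.two_le
    rw [sub_pos, div_lt_one (by linarith)]
    linarith
  have hexp : Complex.exp ((k : ℂ) * (0 - 1) * (Real.log (1 - 1 / (p : ℝ)) : ℂ)) =
      (((1 - 1 / (p : ℝ))⁻¹ ^ k : ℝ) : ℂ) := by
    have h : (k : ℂ) * (0 - 1) * (Real.log (1 - 1 / (p : ℝ)) : ℂ) =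
        ((-(k * Real.log (1 - 1 / (p : ℝ))) : ℝ) : ℂ) := by
      push_cast
      ring
    rw [h, ← Complex.ofReal_exp, Real.exp_neg, Real.exp_nat_mul, Real.exp_log hpos, inv_pow]
  rw [localFactor_zero f hp', hexp]
  push_cast
  ring

/-! ### The registered stub -/

/-- **stub_eulerFactor** (registered stub of the checked skeleton of line `beta-thinned-root-kernel`):
granted the local counts of every Bateman–Horn system, the explicit Euler factor
`λ_f = eulerFactor f` of a Bateman–Horn system is holomorphic on `|z| < 2` and
`λ_f(0) = batemanHornConst f`. [folklore] -/
theorem stub_eulerFactor : (∀ (k : ℕ) (f : Fin k → ℤ[X]), LocalCounts k f) →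
    ∀ (k : ℕ) (f : Fin k → ℤ[X]), EulerFactorClause k f := by
  intro hLC k f hf
  obtain ⟨L, hL⟩ := AZFG2020_tendsto_sum_sub_omega_div_holds k f hf
  obtain ⟨Φ, hΦd, hΦt⟩ := exists_differentiableOn_tendsto_prod f hf (hLC k f)
  have hlim : ∀ z ∈ Metric.ball (0 : ℂ) 2,
      Tendsto (fun N : ℕ => ∏ p ∈ Nat.primesLE N, localFactor f p z *
        Complex.exp ((k : ℂ) * (z - 1) * (Real.log (1 - 1 / (p : ℝ)) : ℂ))) atTop
        (𝓝 (Φ z * Complex.exp (-((z - 1) * (L : ℂ))))) := by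
    intro z hz
    refine Tendsto.congr (fun N => (prod_primesLE_eq f N z).symm) ?_
    refine ((hΦt z hz).comp (tendsto_add_atTop_nat 1)).mul ?_
    refine (Complex.continuous_exp.tendsto _).comp ?_
    exact (((Complex.continuous_ofReal.tendsto L).comp hL).const_mul (z - 1)).neg
  refine ⟨(hΦd.mul (by fun_prop)).congr fun z hz => (hlim z hz).limUnder_eq, ?_⟩
  have h0 : Tendsto (fun N : ℕ => ∏ p ∈ Nat.primesLE N, localFactor f p 0 *
      Complex.exp ((k : ℂ) * (0 - 1) * (Real.log (1 - 1 / (p : ℝ)) : ℂ))) atTop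
      (𝓝 ((batemanHornConst f : ℝ) : ℂ)) := by
    refine Tendsto.congr (fun N => (prod_primesLE_zero f N).symm) ?_
    exact (Complex.continuous_ofReal.tendsto _).comp
      (IsBatemanHornSystem.hasBatemanHornConst_holds hf).1
  exact h0.limUnder_eq

end Summit.Parity.BatemanHorn.Cruxes.SystemLSDRealSegment.BetaThinnedRootKernel
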